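import Summits.ValiantsHypothesis.ValiantsHypothesis.Theorems.LacunarySymmetroidMatrixDescartesDoorA26WallBubblingMultiplicityDescartes
import Summits.ValiantsHypothesis.ValiantsHypothesis.Theorems.LacunarySymmetroidMatrixDescartesDoorA26WallBubblingLocalOrderSigns

/-!
# `DoorA26` / line `wall_bubbling` — the p⋆-TEST BUDGET: six vanishing orders of `pol(p⋆, P(·))` force `det P ≤ 0` and kill every odd-order zero

HONEST FRAMING.  Object-search cell `pub-symmetroid`, crux `Theses.LacunarySymmetroid.DoorA26` (stmt-ValiantsHypothesis-19979; OPEN, typed,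
never asserted).  W2 seat val-sym-door-p1 g19, file #76; def-free helper for obligation (R) of `Cruxes/DoorA26/Lines/wall_bubbling.lean` — step
(ii⋆) of the p⋆-CENTRED no-balance for order-3 profiles (memo `DOOR-A26-P1G19-NO-BALANCE.md` §7c): the test function `g(t) = pol(p⋆, P(t))`
(`pol(X,Y) = det(X+Y) − det X − det Y`, `p⋆` a non-zero singular symmetric matrix — the value of the pencil at the multiple zero) is the 6-term
exponential sum with coefficients `pol(p⋆, S_l)`; if its vanishing orders on a finite set add up to `≥ 6` (parallel touches + nodes + the double zero
at `t⋆`), Laguerre (#64) makes all coefficients vanish, the letters lie in the tangent plane at `p⋆`, `det P ≤ 0` everywhere (#68), and `det P` has no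
zero of odd exact order (#68) — contradicting a triple zero.  Imports #64 `…MultiplicityDescartes`, #68 `…LocalOrderSigns`.

WHAT IS HERE.  `pol_expPencil_eq_expSum` (the test function as an exponential sum), `letters_polar_eq_zero_of_orders` (budget `≥ 6` ⇒ all
`pol(p⋆, S_l) = 0`), ★ `even_order_of_pstar_budget` (⇒ every zero of `det P` of exact order `k` has `k` even).  Nothing here bears on `DoorA26`,
`DoorA34`, (W)/(M)/(R), `MatrixDescartes` (18050) or `VP ≠ VNP`; registers unchanged.

[folklore] Laguerre's rule with multiplicity; tangent plane of the null cone.  [this work] the packaging.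
-/

set_option linter.dupNamespace false

namespace Summit.ValiantsHypothesis.ValiantsHypothesis.Theorems.LacunarySymmetroidMatrixDescartes.WallBubbling

open Finset Filter Topology
open Bubbling (expSum)

/-- The p⋆-test function `t ↦ det(p + P(t)) − det p − det P(t)` is the exponential sum with exponents `δ` and coefficients
`det(p + S_l) − det p − det S_l`. [folklore] -/
theorem pol_expPencil_eq_expSum (δ : Fin 6 → ℝ) (S : Fin 6 → Matrix (Fin 2) (Fin 2) ℝ) (p : Matrix (Fin 2) (Fin 2) ℝ) :
    (fun t => (p + ∑ l, Real.exp (δ l * t) • S l).det - p.det - (∑ l, Real.exp (δ l * t) • S l).det)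
      = expSum (fun l => (p + S l).det - p.det - (S l).det) δ := by
  funext t
  have hlin : ∀ Q : Matrix (Fin 2) (Fin 2) ℝ, (p + Q).det - p.det - Q.det = p 0 0 * Q 1 1 + Q 0 0 * p 1 1 - p 0 1 * Q 1 0 - Q 0 1 * p 1 0 := by
    intro Q
    simp only [Matrix.det_fin_two, Matrix.add_apply]
    ring
  rw [hlin]
  unfold Bubbling.expSum
  simp only [hlin, Matrix.sum_apply, Matrix.smul_apply, smul_eq_mul, Finset.mul_sum, Finset.sum_mul, ← Finset.sum_add_distrib,
    ← Finset.sum_sub_distrib]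
  exact Finset.sum_congr rfl fun l _ => by ring

/-- **Budget of the p⋆-test.**  If `t ↦ pol(p, P(t))` vanishes to total order `≥ 6` on a finite set (orders `m z` at the points `z ∈ Z`), then
every letter is `pol`-orthogonal to `p`. [folklore] (Laguerre with multiplicity, #64) -/
theorem letters_polar_eq_zero_of_orders (δ : Fin 6 → ℝ) (hδ : StrictMono δ) (S : Fin 6 → Matrix (Fin 2) (Fin 2) ℝ)
    (p : Matrix (Fin 2) (Fin 2) ℝ) (Z : Finset ℝ) (m : ℝ → ℕ)
    (hvan : ∀ z ∈ Z, ∀ k < m z,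
      iteratedDeriv k (fun t => (p + ∑ l, Real.exp (δ l * t) • S l).det - p.det - (∑ l, Real.exp (δ l * t) • S l).det) z = 0)
    (hm : 6 ≤ ∑ z ∈ Z, m z) : ∀ l, (p + S l).det - p.det - (S l).det = 0 := by
  by_contra hne
  push Not at hne
  obtain ⟨l₀, hl₀⟩ := hne
  have ha : (fun l => (p + S l).det - p.det - (S l).det) ≠ 0 := fun h => hl₀ (by simpa using congrFun h l₀)
  have hvan' : ∀ z ∈ Z, ∀ k < m z, iteratedDeriv k (expSum (fun l => (p + S l).det - p.det - (S l).det) δ) z = 0 := by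
    intro z hz k hk
    rw [← pol_expPencil_eq_expSum]; exact hvan z hz k hk
  have := sum_order_le_of_expSum 5 δ hδ.injective _ ha Z m hvan'
  omega

/-- ★ **The p⋆-test kills odd-order zeros.**  `p` symmetric, singular, non-zero; symmetric letters; if `pol(p, P(·))` vanishes to total order `≥ 6`
on a finite set, then `det P ≤ 0` on `ℝ` and every zero of `det P` of exact order `k` (`(det P)^{(j)}(t₀) = 0` for `j < k`, `≠ 0` for `j = k`) has
`k` even — in particular `det P` has no triple zero. [this work] -/
theorem even_order_of_pstar_budget (δ : Fin 6 → ℝ) (hδ : StrictMono δ) (S : Fin 6 → Matrix (Fin 2) (Fin 2) ℝ) (hS : ∀ l, (S l).IsSymm)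
    (p : Matrix (Fin 2) (Fin 2) ℝ) (hp : p.IsSymm) (hdet : p.det = 0) (hne : p ≠ 0) (Z : Finset ℝ) (m : ℝ → ℕ)
    (hvan : ∀ z ∈ Z, ∀ k < m z,
      iteratedDeriv k (fun t => (p + ∑ l, Real.exp (δ l * t) • S l).det - p.det - (∑ l, Real.exp (δ l * t) • S l).det) z = 0)
    (hm : 6 ≤ ∑ z ∈ Z, m z) (t₀ : ℝ) (k : ℕ)
    (hk : ∀ j < k, iteratedDeriv j (fun t => (∑ l, Real.exp (δ l * t) • S l).det) t₀ = 0)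
    (hkk : iteratedDeriv k (fun t => (∑ l, Real.exp (δ l * t) • S l).det) t₀ ≠ 0) :
    (∀ t, (∑ l, Real.exp (δ l * t) • S l).det ≤ 0) ∧ Even k := by
  classical
  have hpol := letters_polar_eq_zero_of_orders δ hδ S p Z m hvan hm
  have hle : ∀ t, (∑ l, Real.exp (δ l * t) • S l).det ≤ 0 :=
    fun t => det_nonpos_of_letters_polar_eq_zero p hp hdet hne S hS hpol (fun l => Real.exp (δ l * t))
  refine ⟨hle, ?_⟩
  -- `det P` as an exponential sum on the Leibniz index
  have hF := det_expPencil_eq_expSum_fun δ S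
  set aD : Equiv.Perm (Fin 2) × (Fin 2 → Fin 6) → ℝ := fun p => ((Equiv.Perm.sign p.1 : ℤ) : ℝ) * ∏ i, S (p.2 i) (p.1 i) i
  set x : Equiv.Perm (Fin 2) × (Fin 2 → Fin 6) → ℝ := fun p => ∑ i, δ (p.2 i)
  have hle' : ∀ t, expSum aD x t ≤ 0 := fun t => by have := hle t; rwa [show (∑ l, Real.exp (δ l * t) • S l).det = expSum aD x t from congrFun hF t] at this
  refine even_order_of_expSum_nonpos aD x hle' t₀ k (fun j hj => ?_) ?_
  · rw [← congrFun (iteratedDeriv_expSum aD x j) t₀, ← hF]; exact hk j hj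
  · rw [← congrFun (iteratedDeriv_expSum aD x k) t₀, ← hF]; exact hkk

end Summit.ValiantsHypothesis.ValiantsHypothesis.Theorems.LacunarySymmetroidMatrixDescartes.WallBubbling
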